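import Literature.Combinatorics.SimpleGraph.StarDecomposition
import Literature.Combinatorics.SimpleGraph.TreewidthDualityGlue
import HarnessLib

/-!
# The tree-width duality theorem of Seymour–Thomas (tree-width duality, III)

Topic `Literature/Combinatorics/SimpleGraph`; conclusion of `TreeDecompositionPetals.lean`,
`StarDecomposition.lean`, `TreewidthDualitySide.lean` and `TreewidthDualityGlue.lean`.

**Theorem** (Seymour–Thomas 1993; Diestel, *Graph Theory* 5th ed., Thm. 12.4.3). *Let `k ≥ 0`.
A graph has tree-width `≥ k` iff it contains a bramble of order `> k`.* We prove the hard
("only if") direction for finite graphs and `k ≥ 1` (`exists_isBramble_of_le_treewidth`) and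
deduce the form in which it is used — a HAVEN of order `k + 1`, i.e. a winning strategy for the
Robber against `k` cops in the cops-and-robber game (`exists_isHaven_of_le_treewidth`;
Seymour–Thomas (1.4) (iv) ⇒ (i); this is Chen–Flum–Liu's Thm. 11.2, used for their Thm. 11.1 on
Cai–Fürer–Immerman graphs in `Literature.ModelTheory.FiniteModelTheory.CFIUncolouredProofs`).

Proof, following Diestel's 5th edition (Mazoit's argument) verbatim:
* `petalSet G k` — all petals of good tree-decompositions (over finite index types in the
  universe of `V`); `Adm G k ℬ` — families of petals with (i) a petal of every good decomposition
  and (ii) closed under supersets among petals; if `tw(G) ≥ k ≥ 1` every good decomposition has a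
  petal, so the family of all petals is admissible (`exists_adm`);
* for a cardinality-minimal admissible `ℬ`: no `≤ k` vertices cover its connected members
  (`Adm.exists_disjoint`, star decompositions); removing a `⊆`-minimal `X ∈ ℬ` breaks (i), giving a
  good decomposition whose only petal in `ℬ` is `X`, which may be trimmed
  (`Adm.exists_only_petal`, `Adm.exists_only_petal_trim`); hence any two members of `ℬ` touch
  (`Adm.touches`, by the gluing lemma (∗) `exists_glue`);
* the connected members of `ℬ` form the bramble; the haven is `IsBramble.isHaven_brambleFlap`
  (`Bramble.lean`).

NOT here: the easy converse (a bramble of order `> k` forces tree-width `≥ k`), the case `k = 0`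
(a nonempty graph has the bramble `{{v}}`), infinite graphs.

## References

* [SeymourThomas1993] P. D. Seymour, R. Thomas, *Graph searching and a min-max theorem for
  tree-width*, J. Combin. Theory Ser. B 58 (1993) 22–33, (1.4)–(1.5).
* [Diestel2017] R. Diestel, *Graph Theory*, 5th ed., GTM 173 (2017), Thm. 12.4.3 with proof.
  Read: galaxy `panama:346492191637568`, chars 1024985–1046000.
* F. Mazoit, *A simple proof of the tree-width duality theorem*, arXiv:1309.2266 (2013).
* Y. Chen, J. Flum, M. Liu, arXiv:2507.01459 (2025), Thm. 11.2 (the statement used downstream).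
-/

namespace Literature.Combinatorics.SimpleGraph

open _root_.SimpleGraph

universe u

variable {V : Type u} [Fintype V] [DecidableEq V] (G : _root_.SimpleGraph V) (k : ℕ)

/-! ### Petals of good decompositions, admissible families -/

/-- The set of all petals of good tree-decompositions of `G` (for the threshold `k`), over all
finite index types. [cite: Diestel2017, Thm. 12.4.3 (proof: "the set ℬ of all petals of good
tree-decompositions")] -/
def petalSet : Set (Finset V) :=
  {Z | ∃ (ι : Type u) (_ : Finite ι) (D : TreeDecomposition G ι), D.Good k ∧ D.IsPetal k Z}

/-- An **admissible family** of petals: it contains a petal of every good tree-decomposition and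
is closed under taking supersets among petals (conditions (i), (ii) of Diestel's proof).
[cite: Diestel2017, Thm. 12.4.3 (proof, (i)–(ii))] -/
structure Adm (ℬ : Finset (Finset V)) : Prop where
  /-- its elements are petals of good decompositions -/
  subset : ∀ ⦃Z⦄, Z ∈ ℬ → Z ∈ petalSet G k
  /-- (i) it contains a petal of every good tree-decomposition -/
  hit : ∀ (ι : Type u) [Finite ι] (D : TreeDecomposition G ι), D.Good k → ∃ Z ∈ ℬ, D.IsPetal k Z
  /-- (ii) it is closed under supersets among petals -/
  up : ∀ ⦃Z⦄, Z ∈ ℬ → ∀ ⦃Z'⦄, Z' ∈ petalSet G k → Z ⊆ Z' → Z' ∈ ℬ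

variable {G k}

/-- If `tw(G) ≥ k ≥ 1`, every good tree-decomposition has a petal. [cite: Diestel2017, Thm. 12.4.3
(proof: "Since tw(G) ≥ k, every good tree-decomposition of G has a petal")] -/
theorem exists_isPetal_of_le_treewidth (hk : 1 ≤ k) (htw : k ≤ treewidth G) {ι : Type*} [Finite ι]
    (D : TreeDecomposition G ι) (hD : D.Good k) : ∃ Z, D.IsPetal k Z := by
  by_contra h
  push Not at h
  haveI := Fintype.ofFinite ι
  have := TreeDecomposition.treewidth_lt_of_forall_card_le D hk (hD.card_le_of_forall_not_isPetal h)
  omega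

/-- If `tw(G) ≥ k ≥ 1`, the family of ALL petals is admissible. [cite: Diestel2017, Thm. 12.4.3
(proof)] -/
theorem exists_adm (hk : 1 ≤ k) (htw : k ≤ treewidth G) : ∃ ℬ : Finset (Finset V), Adm G k ℬ := by
  classical
  refine ⟨Finset.univ.filter fun Z => Z ∈ petalSet G k, fun Z hZ => (Finset.mem_filter.1 hZ).2,
    fun ι _ D hD => ?_, fun Z _ Z' hZ' _ => Finset.mem_filter.2 ⟨Finset.mem_univ _, hZ'⟩⟩
  obtain ⟨Z, hZ⟩ := exists_isPetal_of_le_treewidth hk htw D hD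
  exact ⟨Z, Finset.mem_filter.2 ⟨Finset.mem_univ _, ι, ‹_›, D, hD, hZ⟩, hZ⟩

/-! ### A minimal admissible family -/

section Minimal

variable {ℬ : Finset (Finset V)} (hℬ : Adm G k ℬ) (hmin : ∀ ℬ', Adm G k ℬ' → ℬ.card ≤ ℬ'.card)
include hℬ

omit [Fintype V] in
/-- Elements of an admissible family are nonempty (petals are). [cite: Diestel2017, Thm. 12.4.3
(proof)] -/
theorem Adm.nonempty_of_mem {Z : Finset V} (hZ : Z ∈ ℬ) : Z.Nonempty := by
  obtain ⟨ι, _, D, hD, hZ'⟩ := hℬ.subset hZ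
  exact hZ'.nonempty hD

/-- **Order.** No set of at most `k` vertices covers the connected members of an admissible family:
the star decomposition from `S` is good, so the family contains one of its petals, a component of
`G - S`. [cite: Diestel2017, Thm. 12.4.3 (proof: "no set S of at most k vertices covers ℬ'")] -/
theorem Adm.exists_disjoint (S : Finset V) (hS : S.card ≤ k) :
    ∃ Z ∈ ℬ, IsConnectedSet G ↑Z ∧ Disjoint Z S := by
  obtain ⟨Z, hZ, hZp⟩ := hℬ.hit _ (starDecomposition G S) (good_starDecomposition hS)
  obtain ⟨c, hc⟩ := exists_eq_compSet_of_isPetal hS hZp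
  refine ⟨Z, hZ, hc ▸ isConnectedSet_compSet c, Finset.disjoint_left.2 fun v hv => ?_⟩
  exact not_mem_of_mem_compSet (hc ▸ (Finset.mem_coe.2 hv) : v ∈ compSet c)

include hmin

omit [Fintype V] in
/-- In a minimal admissible family, removing a `⊆`-minimal element `X` destroys (i): some good
tree-decomposition has `X` as its only petal in the family. [cite: Diestel2017, Thm. 12.4.3
(proof: "there exists a good tree-decomposition (T₁, 𝒱₁) whose only petal in ℬ is X")] -/
theorem Adm.exists_only_petal {X : Finset V} (hX : X ∈ ℬ) (hXmin : ∀ Z ∈ ℬ, Z ⊆ X → Z = X) :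
    ∃ (ι : Type u) (_ : Finite ι) (D : TreeDecomposition G ι), D.Good k ∧ D.IsPetal k X ∧
      ∀ Z, D.IsPetal k Z → Z ∈ ℬ → Z = X := by
  classical
  have hnot : ¬ Adm G k (ℬ.erase X) := fun h => by
    have := hmin _ h
    rw [Finset.card_erase_of_mem hX] at this
    have hpos : 0 < ℬ.card := Finset.card_pos.2 ⟨X, hX⟩
    omega
  -- (ii) and the subset condition survive, so (i) fails
  have hhit : ¬ ∀ (ι : Type u) [Finite ι] (D : TreeDecomposition G ι), D.Good k →
      ∃ Z ∈ ℬ.erase X, D.IsPetal k Z := by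
    intro h
    refine hnot ⟨fun Z hZ => hℬ.subset (Finset.mem_of_mem_erase hZ), h, fun Z hZ Z' hZ' hZZ' => ?_⟩
    refine Finset.mem_erase.2 ⟨?_, hℬ.up (Finset.mem_of_mem_erase hZ) hZ' hZZ'⟩
    rintro rfl
    exact (Finset.mem_erase.1 hZ).1 (hXmin Z (Finset.mem_of_mem_erase hZ) hZZ')
  push Not at hhit
  obtain ⟨ι, _, D, hD, hD'⟩ := hhit
  have honly : ∀ Z, D.IsPetal k Z → Z ∈ ℬ → Z = X := fun Z hZp hZ => by
    by_contra hne
    exact hD' Z (Finset.mem_erase.2 ⟨hne, hZ⟩) hZp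
  obtain ⟨Z, hZ, hZp⟩ := hℬ.hit ι D hD
  obtain rfl := honly Z hZp hZ
  exact ⟨ι, ‹_›, D, hD, hZp, honly⟩

/-- The same, with the leaf bag trimmed to `X ∪ N(X)` (the trimmed bag stays big, as otherwise the
trimmed decomposition would be a good one without petals in the family).
[cite: Diestel2017, Thm. 12.4.3 (proof: "we may assume that these parts are exactly X ∪ N(X)")] -/
theorem Adm.exists_only_petal_trim {X : Finset V} (hX : X ∈ ℬ) (hXmin : ∀ Z ∈ ℬ, Z ⊆ X → Z = X) :
    ∃ (ι : Type u) (_ : Finite ι) (D : TreeDecomposition G ι) (x x' : ι), D.Good k ∧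
      IsLeafAt D.tree x x' ∧ k < (D.bag x).card ∧ X = D.bag x \ D.bag x' ∧
      (∀ u ∈ D.bag x, u ∈ D.bag x \ D.bag x' ∨ u ∈ outNbrs G (D.bag x \ D.bag x')) ∧
      ∀ Z, D.IsPetal k Z → Z ∈ ℬ → Z = X := by
  classical
  obtain ⟨ι, _, D, hD, ⟨x, x', hx, hbig, rfl⟩, honly⟩ := hℬ.exists_only_petal hmin hX hXmin
  letI : DecidableEq ι := Classical.decEq ι
  set B' : Finset V := (D.bag x).filter fun u =>
    u ∈ D.bag x \ D.bag x' ∨ u ∈ outNbrs G (D.bag x \ D.bag x') with hB'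
  have hsub : B' ⊆ D.bag x := Finset.filter_subset _ _
  have hXB' : D.bag x \ D.bag x' ⊆ B' := fun u hu =>
    Finset.mem_filter.2 ⟨(Finset.mem_sdiff.1 hu).1, Or.inl hu⟩
  have hN : ∀ ⦃u v⦄, G.Adj u v → v ∈ D.bag x \ D.bag x' → u ∈ B' := fun u v huv hv => by
    refine Finset.mem_filter.2 ⟨TreeDecomposition.mem_bag_of_adj_of_mem_sdiff' hx hv huv, ?_⟩
    by_cases hu : u ∈ D.bag x \ D.bag x'
    · exact Or.inl hu
    · exact Or.inr (mem_outNbrs.2 ⟨hu, v, hv, huv⟩)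
  set D' := D.trimLeaf hx B' hsub hXB' hN with hD'
  have hD'good : D'.Good k := hD.trimLeaf hx B' hsub hXB' hN
  -- the trimmed bag is still big
  have hB'big : k < B'.card := by
    by_contra hle
    obtain ⟨Z, hZ, hZp⟩ := hℬ.hit ι D' hD'good
    obtain rfl := honly Z (hZp.of_trimLeaf hx B' hsub hXB' hN hD hbig) hZ
    exact TreeDecomposition.not_isPetal_trimLeaf_self hx B' hsub hXB' hN hD hbig (not_lt.1 hle) hZp
  have hbag : D'.bag x = B' := by rw [hD', TreeDecomposition.trimLeaf_bag, if_pos rfl]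
  have hbag' : D'.bag x' = D.bag x' := by
    rw [hD', TreeDecomposition.trimLeaf_bag, if_neg hx.1.ne']
  have hsd : D'.bag x \ D'.bag x' = D.bag x \ D.bag x' := by
    rw [hbag, hbag', TreeDecomposition.sdiff_eq_of_subset hsub hXB']
  refine ⟨ι, ‹_›, D', x, x', hD'good, hx, hbag ▸ hB'big, hsd.symm, fun u hu => ?_,
    fun Z hZp hZ => ?_⟩
  · rw [hsd]
    rw [hbag] at hu
    exact (Finset.mem_filter.1 hu).2
  · exact honly Z (hZp.of_trimLeaf hx B' hsub hXB' hN hD hbig) hZ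

/-- **Touching.** Any two elements of a minimal admissible family touch. [cite: Diestel2017,
Thm. 12.4.3 (proof: "We complete our proof by showing that every two sets in ℬ touch")] -/
theorem Adm.touches {X₀ Y₀ : Finset V} (hX₀ : X₀ ∈ ℬ) (hY₀ : Y₀ ∈ ℬ) : Touches G ↑X₀ ↑Y₀ := by
  classical
  by_contra hXY₀
  -- `⊆`-minimal elements below `X₀`, `Y₀`
  have hexmin : ∀ W₀ ∈ ℬ, ∃ W ∈ ℬ, W ⊆ W₀ ∧ ∀ Z ∈ ℬ, Z ⊆ W → Z = W := by
    intro W₀ hW₀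
    obtain ⟨W, hW, hWmin⟩ := Finset.exists_min_image (ℬ.filter (· ⊆ W₀)) Finset.card
      ⟨W₀, Finset.mem_filter.2 ⟨hW₀, subset_rfl⟩⟩
    obtain ⟨hWℬ, hWW₀⟩ := Finset.mem_filter.1 hW
    refine ⟨W, hWℬ, hWW₀, fun Z hZ hZW => Finset.eq_of_subset_of_card_le hZW ?_⟩
    exact hWmin Z (Finset.mem_filter.2 ⟨hZ, hZW.trans hWW₀⟩)
  obtain ⟨X, hX, hXX₀, hXmin⟩ := hexmin X₀ hX₀
  obtain ⟨Y, hY, hYY₀, hYmin⟩ := hexmin Y₀ hY₀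
  have hXY : ¬ Touches G ↑X ↑Y := fun h =>
    hXY₀ (h.mono (Finset.coe_subset.2 hXX₀) (Finset.coe_subset.2 hYY₀))
  -- good decompositions having `X`, `Y` as their only petals in `ℬ`, trimmed
  obtain ⟨ι₁, _, D₁, x, x', hD₁, hx, hxbig, hXeq, htrim₁, honly₁⟩ :=
    hℬ.exists_only_petal_trim hmin hX hXmin
  obtain ⟨ι₂, _, D₂, y, y', hD₂, hy, hybig, hYeq, htrim₂, honly₂⟩ :=
    hℬ.exists_only_petal_trim hmin hY hYmin
  rw [hXeq, hYeq] at hXY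
  -- glue
  obtain ⟨D, R, R', hD, hRR', hXR, hYR', hpet⟩ :=
    exists_glue hD₁ hx hxbig htrim₁ hD₂ hy hybig htrim₂ hXY
  obtain ⟨Z, hZ, hZp⟩ := hℬ.hit (ι₁ ⊕ ι₂) D hD
  rcases hpet Z hZp with ⟨hZR', Z₁, hZ₁, hZZ₁⟩ | ⟨hZR, Z₂, hZ₂, hZZ₂⟩
  · have hZ₁ℬ : Z₁ ∈ ℬ := hℬ.up hZ ⟨ι₁, ‹_›, D₁, hD₁, hZ₁⟩ hZZ₁
    obtain rfl := honly₁ Z₁ hZ₁ hZ₁ℬ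
    obtain rfl := hXmin Z hZ hZZ₁
    obtain ⟨v, hv⟩ := hℬ.nonempty_of_mem hZ
    have hv' : v ∈ (↑(D₁.bag x \ D₁.bag x') : Set V) := by rw [← hXeq]; exact hv
    exact Set.disjoint_left.1 hRR' (hXR hv') (hZR' hv)
  · have hZ₂ℬ : Z₂ ∈ ℬ := hℬ.up hZ ⟨ι₂, ‹_›, D₂, hD₂, hZ₂⟩ hZZ₂
    obtain rfl := honly₂ Z₂ hZ₂ hZ₂ℬ
    obtain rfl := hYmin Z hZ hZZ₂
    obtain ⟨v, hv⟩ := hℬ.nonempty_of_mem hZ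
    have hv' : v ∈ (↑(D₂.bag y \ D₂.bag y') : Set V) := by rw [← hYeq]; exact hv
    exact Set.disjoint_left.1 hRR' (hZR hv) (hYR' hv')

end Minimal

/-! ### The duality theorem -/

variable (G) in
/-- **Tree-width duality theorem (Seymour–Thomas 1993), the hard direction: large tree-width forces
a bramble of large order.** If `tw(G) ≥ k ≥ 1` then `G` has a bramble that no set of at most `k`
vertices covers (a bramble of order `> k`; sizes by `Set.encard`, all sets being finite here).
Proof (Mazoit; Diestel, Thm. 12.4.3): take a
cardinality-minimal family `ℬ` of petals of good tree-decompositions containing a petal of every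
good tree-decomposition and closed under supersets among petals; its connected members form the
bramble — no `≤ k` vertices cover them (star decompositions), and any two members of `ℬ` touch
(else glue the two decompositions witnessing their `⊆`-minimal non-touching members by (∗) into a
good decomposition without petals in `ℬ`). (The easy converse — a bramble of order `> k` forces
`tw ≥ k` — is not needed here and not formalised.) [cite: Diestel2017, Thm. 12.4.3]
[cite: SeymourThomas1993, (1.4)–(1.5)] -/
theorem exists_isBramble_of_le_treewidth {k : ℕ} (hk : 1 ≤ k) (htw : k ≤ treewidth G) :
    ∃ ℬ : Set (Set V), IsBramble G ℬ ∧ ∀ X : Set V, X.encard ≤ k → ¬ Covers X ℬ := by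
  classical
  -- a cardinality-minimal admissible family
  obtain ⟨ℬ₀, hℬ₀⟩ := exists_adm hk htw
  obtain ⟨ℬ, hℬmem, hmin⟩ := Finset.exists_min_image (Finset.univ.filter fun ℬ => Adm G k ℬ)
    Finset.card ⟨ℬ₀, Finset.mem_filter.2 ⟨Finset.mem_univ _, hℬ₀⟩⟩
  have hℬ : Adm G k ℬ := (Finset.mem_filter.1 hℬmem).2
  have hmin' : ∀ ℬ', Adm G k ℬ' → ℬ.card ≤ ℬ'.card := fun ℬ' h =>
    hmin ℬ' (Finset.mem_filter.2 ⟨Finset.mem_univ _, h⟩)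
  refine ⟨{B | ∃ Z ∈ ℬ, IsConnectedSet G ↑Z ∧ B = ↑Z}, ⟨?_, ?_⟩, fun X hX hcov => ?_⟩
  · rintro B ⟨Z, -, hZc, rfl⟩
    exact hZc
  · rintro B ⟨Z, hZ, -, rfl⟩ B' ⟨Z', hZ', -, rfl⟩
    exact hℬ.touches hmin' hZ hZ'
  · have hXn : X.ncard ≤ k := by
      have h := hX
      rw [← X.toFinite.cast_ncard_eq] at h
      exact_mod_cast h
    have hXc : X.toFinset.card ≤ k := by rwa [← Set.ncard_eq_toFinset_card']
    obtain ⟨Z, hZ, hZc, hZX⟩ := hℬ.exists_disjoint X.toFinset hXc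
    obtain ⟨v, hvZ, hvX⟩ := hcov ⟨Z, hZ, hZc, rfl⟩
    exact Finset.disjoint_left.1 hZX (Finset.mem_coe.1 hvZ) (Set.mem_toFinset.2 hvX)

variable (G) in
/-- **Large tree-width gives a haven (Seymour–Thomas 1993, Thm (1.4)).** If `tw(G) ≥ k ≥ 1` then
`G` has a haven of order `k + 1` — the Robber has a winning strategy against `k` cops. (From the
bramble of `exists_isBramble_of_le_treewidth` by `IsBramble.isHaven_brambleFlap`.)
[cite: SeymourThomas1993, (1.4) ((iv) ⇒ (i))] -/
theorem exists_isHaven_of_le_treewidth {k : ℕ} (hk : 1 ≤ k) (htw : k ≤ treewidth G) :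
    ∃ β : Set V → Set V, IsHaven G (k + 1) β := by
  obtain ⟨ℬ, hℬ, hk'⟩ := exists_isBramble_of_le_treewidth G hk htw
  exact ⟨_, hℬ.isHaven_brambleFlap hk'⟩

end Literature.Combinatorics.SimpleGraph
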